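import Summits.QuantumFields.YangMills.Theorems.BalabanUVNodesN12MinimiserFamilyAtRecordBjNoPlaqGuard
import Literature.MathematicalPhysics.QuantumFieldTheory.Balaban1983to89.B15Prop1Carrier
import HarnessLib

/-!
# BalabanUVNodes ∕ N12 — THE (J0′) JUNCTION BY NAME: the knit's displayed `hMin` ROW SHAPE (12Q ∕ 12X-W «DIRECT v11», p703802 ∕ p704012) FROM THE w1 LINEAGE's (J0′) PRODUCERS AT THE RECORD
# ([Balaban1989LargeFieldI] (1.74) p.192, Prop. 1 p.194; [Balaban1985Variational] Thm 1 p.279, Sect. C (44)–(48) p.285, (82)–(83) p.290, Prop. 9 (190) p.309; [Balaban1989LargeFieldII] (1.9) p.358;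
# [Balaban1988Convergent] (2.2) p.255, (2.10)–(2.13) pp.256–257; [Balaban1985Averaging] Prop. 2 p.26)

Cell `pub-ymgap` (HUMAN RULINGS D-0062 ∕ D-0149), seat `pub-ymgap-dag-n12-d` g23 (R134 N12 [B15] s2 = by-name knit at the record; census item E1 = the (J0′) row; count-neutral helper of K1⁹
`stmt-QuantumFields-27364`, `--kind proof --supports … --as helper`).  THEOREMS ONLY (0 `def`, 0 `instance`, 0 `sorry`); two compositions BY NAME.

WHAT.  N12's knit pair of record displays the (J0′) row per instance `(P, i)` as TWO BINDERS `R 𝓐₀` and ONE ∀-BODY LETTER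
`hMin : ∀ V_k, PlaqSmallOn (plaqsInside (Z ∩ Λᶜ)^{(k)}) eR V_k → ∃ Ũ holomorphic on the polydisc `ball 0 R`, entrywise bounded by 𝓐₀, whose real points `Ũ(p, B′)` are (2.12) minimisers of
NODE 00's class problem at `𝐁_k(Z)` for the data `Ū(Q^{s*}_k(exp(iB′)·ext(exp(ip)·V_k)))`` (12Q v11 :163–175).  The w1 lineage's producers conclude EXACTLY this ∀-body under `∃ R > 0`:
dag-n12-w1 g4's `N12MinimiserFamilyAtRecordBj.hMin_closedGuard_atRecord_Bj_of_printLetters` (p643087; letters per base field of the CLOSED guard: the minimiser `U₀`, the two (0.4) guards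
`hsbQ`∕`hsbU`, dag-n12-w3's plaquette guards `t₀`, the surjectivity of `DΦ_{U₀}(0)`, (β) on every forest axial slice, (T1@q₀) over the closure of the class; numerics) and dag-n12-w6 g11's
`N12HsurjOfClass.hMin_atRecord_Bj_of_printLetters_hsurjOfClass` (p705019; the surjectivity row DROPPED — supplied from the class by their §1 — at the price of the per-height letters
`hsbU′`∕`hHB` and their floors, inhabited before `ν` by their §2).  THIS FILE states both at the knit's objects — fine-level `Λ`, `ext = extend (pts k Λ) (shellGauge · lo hi)`, `kc := k`,
guard set `plaqsInside (pts k (Z ∩ Λᶜ))`, STRICT guard `PlaqSmallOn` in the conclusion (print's (1.74), `<`), CLOSED guard (`≤`) in the letters (dag-n12-c's LOCATED-R device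
`B15Prop1ClosedGuardUniformRadius.forall_of_forall_isCompact_subset`: read the compact closed guard ONCE, one radius for all guarded base fields; `plaqLeOn_of_plaqSmallOn`) — so that the
K1-side consumer of the knit discharges its `hMin P i` row by `obtain ⟨R, hR, hMin⟩ := exists_R_hMinRow_of_printLetters… ; … (R P i := R) (hMin := hMin)`: the junction BY NAME that HANDOFF
trigger (t107) asked for.

LOCATED (E1, knit side) — WHY THE ROW STAYS A BINDER + LETTER IN THE KNIT.  A knit edition that displayed the producers' per-base-field rows INSTEAD of `R 𝓐₀ hMin` would have to bind the
radius existentially BEFORE its threshold and floor rows: `∃ R > 0, ∀ cJ ≥ 2cA·eR∕R + 2·#S·(1+8𝓐₀⁴)∕(R·eR), ∀ δ ≤ Θ(R), hfloor(δ) → …` with `Θ(R) = min (…) (min 1 (rhs ∕ (max S(R) 0 + 1)))`,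
`S(R) ≥ 40(d−1)·(12𝓐₀∕R·√#bonds(Ω₁(Z)))²`.  Such a statement is VACUOUS BY SHAPE (dag-n12-c g21's LOCATED-FLOOR species, kernel certificate
`B15Prop1NumericsThresholds.exists_threshold_frame_of_pos_floor`): the witness `R ↓ 0` drives `Θ(R) ↓ 0` (whenever `Ω₁(Z)` has a bond), so the k-free floor `C(d,L)·εreg + m′·ρn ≤ δ ≤ Θ(R)`
contradicts `0 < εreg` and every hypothesis list is inconsistent.  A non-vacuous rows-displayed edition needs a DISPLAYED LOWER BOUND for the implicit-function radius (census U4: the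
road's existence constants `R, εH, B₁, M₂, C, ρ, Kτ, ρτ, ρ5, ρ6` are compactness existentials, not print's `(d, L, M)`-numbers) — the same reason the chart half is displayed as the binders
`C ρ Kτ ρτ ρ5` + the ∀-body `hhalf` of dag-n12-c's `exists_hWD_chartHalf_of_class_uniform_rowl1_family`.  Hence: the (J0′) row's display in the knit is FINAL IN SHAPE; producer editions
(today's `_hsurjOfClass`; dag-n12-w6's `_ofClass`; the lane's (r3) `_of_guardOn`) plug in HERE, consumer side, one `obtain` each, and this file grows append-only with them.

CONTENTS.  ★★★ `exists_R_hMinRow_of_printLetters` — the knit's `hMin` row shape under `∃ R > 0` from w1 g4's closed-guard theorem (all of print's per-base-field letters displayed on the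
closed guard).  ★★★ `exists_R_hMinRow_of_printLetters_hsurjOfClass` — the same from dag-n12-w6 g11's edition (no surjectivity row; per-height letters `hsbU′ hHB` + floors displayed),
through `forall_of_forall_isCompact_subset`.  ★★★ `exists_R_hMinRow_of_printLetters_ofClass` — the same from dag-n12-w6 g11's `_ofClass` edition (p707370; neither the `t₀` guards nor the
surjectivity row).

HONEST FRAMING ∕ LOCATED.  Two compositions by name; the per-base-field letters stay DISPLAYED and are, until the lane's (r3) `_of_guardOn` editions land, a (0.4)-REGIME reading (`hsbQ`∕`hsbU`
= `SmallBelow` at every coarse bond of the torus — dag-n12-c g23's LOCATED-E1-HSB; (β)'s kernel premise in `dIterL` currency — LOCATED-E1-DITERL); nothing of Bałaban's asserted; N12 NOT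
discharged; K1⁹ NOT closed; counts unmoved; one finite 𝕋⁴ programme at fixed `ε = L^{-K}` — R4 closes only the conditional rung `BalabanLadder.UV`; no summit statement is proved here and
NOT the Yang–Mills mass gap (Clay); nothing continuum ∕ ℝ⁴ ∕ OS.
-/

noncomputable section

namespace Summit.QuantumFields.YangMills.BalabanUVNodes.N12MinimiserFamilyKnitRow

open scoped BigOperators Matrix.Norms.L2Operator Topology
open Literature.MathematicalPhysics.QuantumFieldTheory.Balaban1983to89
open T4Continuum
open B15DeterminingSets GaugeField
open ExpMeanLog (expMeanLogSU deltaSU)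
open T4AdjointCovarianceUnitary (lieSU)
open Node00
open B15SU2ChartHolomorphic (genE)
open B15Prop1AnalyticExtClause (cplxVec)
open B15Prop1ChartCalculusSU2 (E3)
open T4CubeChartGnomonic (SU2)
open B14.Eq213DetSet (Bj maxDomT Bj_of_gt)
open B14.Eq213MaximalDomains (side)
open B14.Eq216Concrete (feeds)
open B5Eq118OneStroke (iterBlockOf)
open B15Eq112TorusCover (lift)
open T4AxialGaugeSmallField (boxPlaqs)
open Summit.QuantumFields.YangMills.Theorems.BlockAvgCorrector (stokesConst)
open Summit.QuantumFields.YangMills.BalabanUVNodes.N12MinimiserFamilyAtRecordBj (hMin_closedGuard_atRecord_Bj_of_printLetters)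
open Summit.QuantumFields.YangMills.BalabanUVNodes.N12HsurjOfClass (hMin_atRecord_Bj_of_printLetters_hsurjOfClass)
open Summit.QuantumFields.YangMills.BalabanUVNodes.N12MinimiserFamilyAtRecordBjNoPlaqGuard (hMin_atRecord_Bj_of_printLetters_ofClass)
open Literature.MathematicalPhysics.QuantumFieldTheory.BalabanImbrieJaffe1984to88.BIJ85Eq453GaugeField (qsstarGIter0)
open B15AveragingHolomorphic (iterMh)
open B15SU2ChartHolomorphic (expMulC logCoordC)
open B15ShellGauge193 (shellGauge)
open B15Extension193 (extend)
open B16Sect1Backgrounds (toMS expMul)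
open B15Prop1ChartSU2 (su2Chart)
open Metric (ball)
open B15Prop1Carrier (plaqsInside)
open B15Prop1ClosedGuardUniformRadius (forall_of_forall_isCompact_subset plaqLeOn_of_plaqSmallOn)

variable {F : T4Family} {k : ℕ}


/-! ## §1  The knit's `hMin` row shape from w1 g4's closed-guard (J0′) theorem — every per-base-field letter of print displayed -/

/-- ★★★ **THE KNIT's (J0′) ROW SHAPE, UNDER `∃ R > 0`, FROM PRINT's PER-BASE-FIELD LETTERS (w1 g4's closed-guard theorem at the knit's objects).**  For base fields of the CLOSED
small-field guard `{V_k | ∀ p′ ⊂ (Z ∩ Λᶜ)^{(k)}, |V_k(∂p′) − 1| ≤ eR}` the consumer supplies, per `V_k`: a (2.12) minimiser `U₀` of the datum `Ū(Q^{s*}_k(ext V_k))` in NODE 00's class at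
`𝐁_k(Z)` (`kc := k`) with the two (0.4) guards, dag-n12-w3's plaquette guards `t₀`, the surjectivity of `DΦ_{U₀}(0)`, (β) on every forest axial slice through the constrained towers, and
(T1@q₀) over the closure of the class; numerics `k ≤ m+K`, `1 ≤ k`, `M₁L^k ∣ N₀`, `(d+14)·L ≤ M₁`, `0 < εreg`, the [B7] Prop. 2 window at `α₀ := 2L²εreg`.  Conclusion: ONE radius `R > 0`
and, for every base field of the STRICT guard (print's (1.74)), the knit's holomorphic bounded family of minimisers — 12Q ∕ 12X-W v11's `hMin P i` ∀-body verbatim at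
`(ν, Kt, k, Z, Λ, lo, hi, eR, 𝓐₀, ext) := (Θ.ν, P.K, k P i, Z P i, Λ P i, lo P i, hi P i, eR P i, 𝓐₀ P i, ext P i)`.  (0.4)-regime reading until the `_of_guardOn` editions (module docstring).
[cite: Balaban1989LargeFieldI, (1.74) p.192, Prop. 1 p.194 (last clause, analyticity in `B′`); Balaban1985Variational, Thm 1 p.279, (7) p.278, (16)–(18) p.280, Sect. C (44)–(48) p.285, (82)–(83) p.290, Prop. 9 (190) p.309; Balaban1989LargeFieldII, (1.9) p.358, (1.12) p.359; Balaban1988Convergent, (2.2) p.255, (2.10)–(2.13) pp.256–257; Balaban1985Averaging, Prop. 2 (52)–(54) p.26] -/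
theorem exists_R_hMinRow_of_printLetters (ν : Node00.Stage7Numerics) (Kt : ℕ) (Z Λ : Set (Site (F.P Kt) 0))
    (lo hi : Fin (F.P Kt).d → ℤ) (hk : k ≤ (F.P Kt).m + (F.P Kt).K) (hk1 : 1 ≤ k)
    (hdiv : side (F.P Kt).L ν.M₁ k ∣ (F.P Kt).sitesPerDir 0) (hfloor : ((F.P Kt).d + 14) * (F.P Kt).L ≤ ν.M₁) (hε : 0 < ν.εreg)
    (hα3 : (143 * (((((F.P Kt).d + 4 : ℕ) : ℝ)) ^ 2 / 4) ^ 2) * (2 * ((F.P Kt).L : ℝ) ^ 2 * ν.εreg) ≤ 1 / 3)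
    (hα2 : 2 * (2 * ((F.P Kt).L : ℝ) ^ 2 * ν.εreg) ≤ 2 * deltaSU (Fin 2) / ((((F.P Kt).d + 4) * (F.P Kt).L : ℕ) : ℝ) ^ 2)
    (ext : GaugeField (F.P Kt) k SU2 → GaugeField (F.P Kt) k SU2) (hext : ∀ W, ext W = extend (pts k Λ) (shellGauge W lo hi) W)
    {𝓐₀ : ℝ} (h𝓐₀ : 1 < 𝓐₀) (eR : ℝ)
    (hletters : ∀ Vk : GaugeField (F.P Kt) k SU2, (∀ p ∈ plaqsInside (pts k (Z ∩ Λᶜ)), dist1 (GaugeField.plaqHol Vk p) ≤ eR) → ∃ U₀ : GaugeField (F.P Kt) 0 SU2,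
      IsMinimizer (Node00.avOfRecord F 2 Kt) (Node00.regMSCoPOfRecord F 2 ν Kt k (maxDomT ν.M₁ Z)) (Bj ν.M₁ Z k)
        (avgFamily (Node00.avOfRecord F 2 Kt) (qsstarGIter0 k (ext Vk))) U₀ ∧
      SmallBelow (Node00.avOfRecord F 2 Kt) k (qsstarGIter0 k (ext Vk)) ∧
      SmallBelow (Node00.avOfRecord F 2 Kt) k U₀ ∧
      -- dag-n12-w3's plaquette guards `t₀` and the DISPLAYED surjectivity of `DΦ_{U₀}(0)` (both removed in §2 ∕ by dag-n12-w6 g11)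
      (∃ t₀ : ℝ, 0 < t₀ ∧ stokesConst (F.P Kt) * t₀ < deltaSU (Fin 2) ∧ ∀ i, i < k → PlaqSmall t₀ (Averaging.iter (Node00.avOfRecord F 2 Kt) i U₀)) ∧
      Function.Surjective (fderiv ℝ (Node00.msChart F 2 Kt k (Bj ν.M₁ Z k) (avgFamily (Node00.avOfRecord F 2 Kt) U₀) U₀) 0) ∧
      -- DISPLAYED (β) ON EVERY FOREST AXIAL SLICE through the constrained towers of `𝐁_k(Z)`
      (∀ (S : Submodule ℂ (VecField (F.P Kt) 0 (EuclideanSpace ℂ (Fin 3)))) (path : Site (F.P Kt) 0 → List (LStep (F.P Kt) 0)),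
        (∀ x, ∀ s ∈ path x, ∃ x' x'' : Site (F.P Kt) 0, path x'' = path x' ++ [s] ∧
          (s.fwd = true → s.bond.src = x' ∧ s.bond.tgt = x'') ∧ (s.fwd = false → s.bond.src = x'' ∧ s.bond.tgt = x')) →
        (∀ j, j ≤ k → ∀ c ∈ bondsOf (Bj ν.M₁ Z k j), path (embIter j c.src) = [] ∧ path (embIter j c.tgt) = []) →
        (∀ X : VecField (F.P Kt) 0 (EuclideanSpace ℂ (Fin 3)), X ∈ S ↔ ∀ x, ∀ s ∈ path x, X s.bond = 0) →
        ∀ ℓ₀ : (Fin (constrCard (Bj ν.M₁ Z k) k) → EuclideanSpace ℂ (Fin 3)) →L[ℂ] ℂ,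
          fderiv ℂ (fun X : S => ∑ p : Plaq (F.P Kt) 0, (1 - (expMulC (X : VecField (F.P Kt) 0 (EuclideanSpace ℂ (Fin 3))) (coeField U₀) ⟨p.src, p.μ⟩ *
            expMulC (X : VecField (F.P Kt) 0 (EuclideanSpace ℂ (Fin 3))) (coeField U₀) ⟨p.src.shift p.μ, p.ν⟩ *
            Matrix.adjugate (expMulC (X : VecField (F.P Kt) 0 (EuclideanSpace ℂ (Fin 3))) (coeField U₀) ⟨p.src.shift p.ν, p.μ⟩) *
            Matrix.adjugate (expMulC (X : VecField (F.P Kt) 0 (EuclideanSpace ℂ (Fin 3))) (coeField U₀) ⟨p.src, p.ν⟩)).trace / 2)) 0 =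
            ℓ₀.comp (fderiv ℂ (fun (X : S) (i : Fin (constrCard (Bj ν.M₁ Z k) k)) =>
              logCoordC (star ((avgFamily (Node00.avOfRecord F 2 Kt) (qsstarGIter0 k (ext Vk))
                ((constrEnum (Bj ν.M₁ Z k) k).symm i).1 ((constrEnum (Bj ν.M₁ Z k) k).symm i).2.1 : SU2) : Matrix (Fin 2) (Fin 2) ℂ) *
                iterMh ((constrEnum (Bj ν.M₁ Z k) k).symm i).1 (expMulC (X : VecField (F.P Kt) 0 (EuclideanSpace ℂ (Fin 3))) (coeField U₀))
                  ((constrEnum (Bj ν.M₁ Z k) k).symm i).2.1)) 0) →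
          ∀ (p : VecField (F.P Kt) 0 E3) (hp : cplxVec p ∈ S), p ≠ 0 →
            (∀ i : Fin (constrCard (Bj ν.M₁ Z k) k), dIterL ((constrEnum (Bj ν.M₁ Z k) k).symm i).1 (coeField U₀)
              (fun b => (∑ a : Fin 3, ((p b a : ℝ) : ℂ) • genE a) * ((U₀ b : SU2) : Matrix (Fin 2) (Fin 2) ℂ)) ((constrEnum (Bj ν.M₁ Z k) k).symm i).2.1 = 0) →
            0 < deriv (deriv (fun t : ℝ => wilsonAction4 (expMul su2Chart (t • p) U₀) -
              (ℓ₀ ((fun (X : S) (i : Fin (constrCard (Bj ν.M₁ Z k) k)) =>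
                logCoordC (star ((avgFamily (Node00.avOfRecord F 2 Kt) (qsstarGIter0 k (ext Vk))
                  ((constrEnum (Bj ν.M₁ Z k) k).symm i).1 ((constrEnum (Bj ν.M₁ Z k) k).symm i).2.1 : SU2) : Matrix (Fin 2) (Fin 2) ℂ) *
                  iterMh ((constrEnum (Bj ν.M₁ Z k) k).symm i).1 (expMulC (X : VecField (F.P Kt) 0 (EuclideanSpace ℂ (Fin 3))) (coeField U₀))
                    ((constrEnum (Bj ν.M₁ Z k) k).symm i).2.1)) ((t : ℂ) • ⟨cplxVec p, hp⟩))).re)) 0) ∧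
      -- DISPLAYED (T1@q₀) over the CLOSURE of NODE 00's class: the tower-central orbit of `U₀` is the unique minimal orbit
      (∀ U ∈ closure (Node00.regMSCoPOfRecord F 2 ν Kt k (maxDomT ν.M₁ Z)),
        AgreeOn (Bj ν.M₁ Z k) (avgFamily (Node00.avOfRecord F 2 Kt) U) (avgFamily (Node00.avOfRecord F 2 Kt) (qsstarGIter0 k (ext Vk))) →
        wilsonAction4 U ≤ wilsonAction4 U₀ →
          ∃ u : GaugeTransf (F.P Kt) 0 SU2, (∀ j, j ≤ k → ∀ b ∈ bondsOf (Bj ν.M₁ Z k j),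
            toMS u j b.src = toMS u j b.tgt ∧ ∀ g : SU2, toMS u j b.src * g = g * toMS u j b.src) ∧ gaugeAct u U = U₀)) :
    ∃ R : ℝ, 0 < R ∧ ∀ Vk : GaugeField (F.P Kt) k SU2, PlaqSmallOn (plaqsInside (pts k (Z ∩ Λᶜ))) eR Vk →
      ∃ Ũ : VecField (F.P Kt) k (EuclideanSpace ℂ (Fin 3)) × VecField (F.P Kt) k (EuclideanSpace ℂ (Fin 3)) → PBond (F.P Kt) 0 → Matrix (Fin 2) (Fin 2) ℂ,
        (∀ b i j, DifferentiableOn ℂ (fun z => Ũ z b i j) (ball 0 R)) ∧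
        (∀ z ∈ ball (0 : VecField (F.P Kt) k (EuclideanSpace ℂ (Fin 3)) × VecField (F.P Kt) k (EuclideanSpace ℂ (Fin 3))) R, ∀ b i j, ‖Ũ z b i j‖ ≤ 𝓐₀) ∧
        ∀ p B' : VecField (F.P Kt) k E3, ‖p‖ < R → ‖B'‖ < R → ∃ U' : GaugeField (F.P Kt) 0 SU2,
          (∀ b, Ũ (cplxVec p, cplxVec B') b = ((U' b : SU2) : Matrix (Fin 2) (Fin 2) ℂ)) ∧
            IsMinimizer (Node00.avOfRecord F 2 Kt) (Node00.regMSCoPOfRecord F 2 ν Kt k (maxDomT ν.M₁ Z)) (Bj ν.M₁ Z k)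
              (avgFamily (Node00.avOfRecord F 2 Kt) (qsstarGIter0 k (expMul su2Chart B' (ext (expMul su2Chart p Vk))))) U' := by
  obtain ⟨R, hR, h⟩ := hMin_closedGuard_atRecord_Bj_of_printLetters ν Kt k Z (pts k Λ) lo hi hk hk1 (Nat.le_succ k) hdiv hfloor hε hα3 hα2
    ext hext h𝓐₀ (plaqsInside (pts k (Z ∩ Λᶜ))) eR hletters
  exact ⟨R, hR, fun Vk hVk => h Vk (plaqLeOn_of_plaqSmallOn hVk)⟩


/-! ## §2  The same from dag-n12-w6 g11's edition — NO surjectivity row (supplied from the class), per-height letters `hsbU′ hHB` and their floors displayed -/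

/-- ★★★ **THE KNIT's (J0′) ROW SHAPE, UNDER `∃ R > 0`, FROM dag-n12-w6 g11's `hMin_atRecord_Bj_of_printLetters_hsurjOfClass` (p705019).**  As §1 with the surjectivity of `DΦ_{U₀}(0)`
REMOVED from the per-base-field letters (it holds for EVERY (2.12)-class minimiser, `N12HsurjOfClass` §1) at the price of dag-n12-w6's per-HEIGHT letters — the near-flat small-below radius
`ρ″` (`hsbU′`) and the (P4)′ proxies letter `hHB` at `(εH, B)` (both inhabited before `ν`, `N12HsurjOfClass.exists_hsurjLetters`) — with the floors `6(d−1)L·εreg ≤ ρ″`, `εreg ≤ εH` and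
`k + 1 ≤ m + K`.  Read once on the compact closed guard (`forall_of_forall_isCompact_subset`), concluded on the strict guard (`plaqLeOn_of_plaqSmallOn`): the knit's `hMin P i` ∀-body.
[cite: Balaban1989LargeFieldI, (1.74) p.192, Prop. 1 p.194; Balaban1985Variational, Thm 1 p.279, Sect. C (44)–(48) p.285, (82)–(83) p.290, Prop. 9 (190) p.309; Balaban1988Convergent, (2.2) p.255, (2.10)–(2.13) pp.256–257; Balaban1985Averaging, Prop. 2 (52)–(54) p.26] -/
theorem exists_R_hMinRow_of_printLetters_hsurjOfClass (ν : Node00.Stage7Numerics) (Kt : ℕ) (Z Λ : Set (Site (F.P Kt) 0))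
    (lo hi : Fin (F.P Kt).d → ℤ) (hkK : k + 1 ≤ (F.P Kt).m + (F.P Kt).K) (hk1 : 1 ≤ k)
    (hdiv : side (F.P Kt).L ν.M₁ k ∣ (F.P Kt).sitesPerDir 0) (hfloor : ((F.P Kt).d + 14) * (F.P Kt).L ≤ ν.M₁) (hε : 0 < ν.εreg)
    (hα3 : (143 * (((((F.P Kt).d + 4 : ℕ) : ℝ)) ^ 2 / 4) ^ 2) * (2 * ((F.P Kt).L : ℝ) ^ 2 * ν.εreg) ≤ 1 / 3)
    (hα2 : 2 * (2 * ((F.P Kt).L : ℝ) ^ 2 * ν.εreg) ≤ 2 * deltaSU (Fin 2) / ((((F.P Kt).d + 4) * (F.P Kt).L : ℕ) : ℝ) ^ 2)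
    -- the per-HEIGHT letters of §1 (inhabited by §2 before `ν`) and their floors
    {ρ'' : ℝ} (hsbU' : ∀ V : GaugeField (F.P Kt) 0 SU2, ‖coeField V - 1‖ ≤ ρ'' → SmallBelow (avOfRecord F 2 Kt) k V)
    (hερ : 6 * ((((F.P Kt).d - 1 : ℕ)) : ℝ) * (F.P Kt).L * ν.εreg ≤ ρ'')
    {εH B : ℝ}
    (hHB : ∀ (Wd : MSField (F.P Kt) SU2) (U₀ : GaugeField (F.P Kt) 0 SU2),
      AgreeOn (Bj ν.M₁ Z k) (avgFamily (avOfRecord F 2 Kt) U₀) Wd →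
      (∀ i' : Fin (constrCard (Bj ν.M₁ Z k) k), ∃ U' : GaugeField (F.P Kt) 0 SU2,
        (∀ b ∈ feeds (((constrEnum (Bj ν.M₁ Z k) k).symm i').1 : ℕ) ((constrEnum (Bj ν.M₁ Z k) k).symm i').2.1, U' b = U₀ b) ∧
          SmallBelow (avOfRecord F 2 Kt) k U') →
      (∀ (j : ℕ), 1 ≤ j → j ≤ k → ∀ y : Site (F.P Kt) j, embIter j y ∈ maxDomT ν.M₁ Z j → ∃ U' : GaugeField (F.P Kt) 0 SU2,
        (∀ c : PBond (F.P Kt) j, (c.src = y ∨ c.tgt = y) → ∀ b₀ : PBond (F.P Kt) 0,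
          (iterBlockOf j b₀.src = c.src ∨ iterBlockOf j b₀.src = c.tgt) → (iterBlockOf j b₀.tgt = c.src ∨ iterBlockOf j b₀.tgt = c.tgt) → U' b₀ = U₀ b₀) ∧
        SmallBelow (avOfRecord F 2 Kt) k U') →
      (∀ (j : ℕ), 1 ≤ j → j ≤ k → ∀ y : Site (F.P Kt) j, embIter j y ∈ maxDomT ν.M₁ Z j →
        PlaqSmallOn (boxPlaqs (fun κ => lift (F.P Kt) (embIter j y) κ - ((((F.P Kt).L ^ j : ℕ) : ℤ) + ((((F.P Kt).L ^ j - 1) / 2 : ℕ) : ℤ)))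
          (fun κ => lift (F.P Kt) (embIter j y) κ + ((((F.P Kt).L ^ j : ℕ) : ℤ) + ((((F.P Kt).L ^ j - 1) / 2 : ℕ) : ℤ))) : Set (Plaq (F.P Kt) 0)) εH U₀) →
      ∃ H : (Fin (constrCard (Bj ν.M₁ Z k) k) → lieSU (Fin 2)) → PBond (F.P Kt) 0 → lieSU (Fin 2),
        (∀ v, fderiv ℝ (msChart F 2 Kt k (Bj ν.M₁ Z k) Wd U₀) 0 (H v) = v) ∧ ∀ v, Real.sqrt (∑ b, ‖H v b‖ ^ 2) ≤ B * ‖v‖)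
    (hεH : ν.εreg ≤ εH)
    (ext : GaugeField (F.P Kt) k SU2 → GaugeField (F.P Kt) k SU2) (hext : ∀ W, ext W = extend (pts k Λ) (shellGauge W lo hi) W)
    {𝓐₀ : ℝ} (h𝓐₀ : 1 < 𝓐₀) (eR : ℝ)
    (hletters : ∀ Vk : GaugeField (F.P Kt) k SU2, (∀ p ∈ plaqsInside (pts k (Z ∩ Λᶜ)), dist1 (GaugeField.plaqHol Vk p) ≤ eR) → ∃ U₀ : GaugeField (F.P Kt) 0 SU2,
      IsMinimizer (Node00.avOfRecord F 2 Kt) (Node00.regMSCoPOfRecord F 2 ν Kt k (maxDomT ν.M₁ Z)) (Bj ν.M₁ Z k)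
        (avgFamily (Node00.avOfRecord F 2 Kt) (qsstarGIter0 k (ext Vk))) U₀ ∧
      SmallBelow (Node00.avOfRecord F 2 Kt) k (qsstarGIter0 k (ext Vk)) ∧
      SmallBelow (Node00.avOfRecord F 2 Kt) k U₀ ∧
      -- guards in dag-n12-w3's currency (NO surjectivity row any more)
      (∃ t₀ : ℝ, 0 < t₀ ∧ stokesConst (F.P Kt) * t₀ < deltaSU (Fin 2) ∧ ∀ i, i < k → PlaqSmall t₀ (Averaging.iter (Node00.avOfRecord F 2 Kt) i U₀)) ∧
      -- DISPLAYED (β) ON EVERY FOREST AXIAL SLICE through the constrained towers of `𝐁_k(Z)`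
      (∀ (S : Submodule ℂ (VecField (F.P Kt) 0 (EuclideanSpace ℂ (Fin 3)))) (path : Site (F.P Kt) 0 → List (LStep (F.P Kt) 0)),
        (∀ x, ∀ s ∈ path x, ∃ x' x'' : Site (F.P Kt) 0, path x'' = path x' ++ [s] ∧
          (s.fwd = true → s.bond.src = x' ∧ s.bond.tgt = x'') ∧ (s.fwd = false → s.bond.src = x'' ∧ s.bond.tgt = x')) →
        (∀ j, j ≤ k → ∀ c ∈ bondsOf (Bj ν.M₁ Z k j), path (embIter j c.src) = [] ∧ path (embIter j c.tgt) = []) →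
        (∀ X : VecField (F.P Kt) 0 (EuclideanSpace ℂ (Fin 3)), X ∈ S ↔ ∀ x, ∀ s ∈ path x, X s.bond = 0) →
        ∀ ℓ₀ : (Fin (constrCard (Bj ν.M₁ Z k) k) → EuclideanSpace ℂ (Fin 3)) →L[ℂ] ℂ,
          fderiv ℂ (fun X : S => ∑ p : Plaq (F.P Kt) 0, (1 - (expMulC (X : VecField (F.P Kt) 0 (EuclideanSpace ℂ (Fin 3))) (coeField U₀) ⟨p.src, p.μ⟩ *
            expMulC (X : VecField (F.P Kt) 0 (EuclideanSpace ℂ (Fin 3))) (coeField U₀) ⟨p.src.shift p.μ, p.ν⟩ *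
            Matrix.adjugate (expMulC (X : VecField (F.P Kt) 0 (EuclideanSpace ℂ (Fin 3))) (coeField U₀) ⟨p.src.shift p.ν, p.μ⟩) *
            Matrix.adjugate (expMulC (X : VecField (F.P Kt) 0 (EuclideanSpace ℂ (Fin 3))) (coeField U₀) ⟨p.src, p.ν⟩)).trace / 2)) 0 =
            ℓ₀.comp (fderiv ℂ (fun (X : S) (i : Fin (constrCard (Bj ν.M₁ Z k) k)) =>
              logCoordC (star ((avgFamily (Node00.avOfRecord F 2 Kt) (qsstarGIter0 k (ext Vk))
                ((constrEnum (Bj ν.M₁ Z k) k).symm i).1 ((constrEnum (Bj ν.M₁ Z k) k).symm i).2.1 : SU2) : Matrix (Fin 2) (Fin 2) ℂ) *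
                iterMh ((constrEnum (Bj ν.M₁ Z k) k).symm i).1 (expMulC (X : VecField (F.P Kt) 0 (EuclideanSpace ℂ (Fin 3))) (coeField U₀))
                  ((constrEnum (Bj ν.M₁ Z k) k).symm i).2.1)) 0) →
          ∀ (p : VecField (F.P Kt) 0 E3) (hp : cplxVec p ∈ S), p ≠ 0 →
            (∀ i : Fin (constrCard (Bj ν.M₁ Z k) k), dIterL ((constrEnum (Bj ν.M₁ Z k) k).symm i).1 (coeField U₀)
              (fun b => (∑ a : Fin 3, ((p b a : ℝ) : ℂ) • genE a) * ((U₀ b : SU2) : Matrix (Fin 2) (Fin 2) ℂ)) ((constrEnum (Bj ν.M₁ Z k) k).symm i).2.1 = 0) →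
            0 < deriv (deriv (fun t : ℝ => wilsonAction4 (expMul su2Chart (t • p) U₀) -
              (ℓ₀ ((fun (X : S) (i : Fin (constrCard (Bj ν.M₁ Z k) k)) =>
                logCoordC (star ((avgFamily (Node00.avOfRecord F 2 Kt) (qsstarGIter0 k (ext Vk))
                  ((constrEnum (Bj ν.M₁ Z k) k).symm i).1 ((constrEnum (Bj ν.M₁ Z k) k).symm i).2.1 : SU2) : Matrix (Fin 2) (Fin 2) ℂ) *
                  iterMh ((constrEnum (Bj ν.M₁ Z k) k).symm i).1 (expMulC (X : VecField (F.P Kt) 0 (EuclideanSpace ℂ (Fin 3))) (coeField U₀))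
                    ((constrEnum (Bj ν.M₁ Z k) k).symm i).2.1)) ((t : ℂ) • ⟨cplxVec p, hp⟩))).re)) 0) ∧
      -- DISPLAYED (T1@q₀) over the CLOSURE of NODE 00's class: the tower-central orbit of `U₀` is the unique minimal orbit
      (∀ U ∈ closure (Node00.regMSCoPOfRecord F 2 ν Kt k (maxDomT ν.M₁ Z)),
        AgreeOn (Bj ν.M₁ Z k) (avgFamily (Node00.avOfRecord F 2 Kt) U) (avgFamily (Node00.avOfRecord F 2 Kt) (qsstarGIter0 k (ext Vk))) →
        wilsonAction4 U ≤ wilsonAction4 U₀ →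
          ∃ u : GaugeTransf (F.P Kt) 0 SU2, (∀ j, j ≤ k → ∀ b ∈ bondsOf (Bj ν.M₁ Z k j),
            toMS u j b.src = toMS u j b.tgt ∧ ∀ g : SU2, toMS u j b.src * g = g * toMS u j b.src) ∧ gaugeAct u U = U₀)) :
    ∃ R : ℝ, 0 < R ∧ ∀ Vk : GaugeField (F.P Kt) k SU2, PlaqSmallOn (plaqsInside (pts k (Z ∩ Λᶜ))) eR Vk →
      ∃ Ũ : VecField (F.P Kt) k (EuclideanSpace ℂ (Fin 3)) × VecField (F.P Kt) k (EuclideanSpace ℂ (Fin 3)) → PBond (F.P Kt) 0 → Matrix (Fin 2) (Fin 2) ℂ,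
        (∀ b i j, DifferentiableOn ℂ (fun z => Ũ z b i j) (ball 0 R)) ∧
        (∀ z ∈ ball (0 : VecField (F.P Kt) k (EuclideanSpace ℂ (Fin 3)) × VecField (F.P Kt) k (EuclideanSpace ℂ (Fin 3))) R, ∀ b i j, ‖Ũ z b i j‖ ≤ 𝓐₀) ∧
        ∀ p B' : VecField (F.P Kt) k E3, ‖p‖ < R → ‖B'‖ < R → ∃ U' : GaugeField (F.P Kt) 0 SU2,
          (∀ b, Ũ (cplxVec p, cplxVec B') b = ((U' b : SU2) : Matrix (Fin 2) (Fin 2) ℂ)) ∧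
            IsMinimizer (Node00.avOfRecord F 2 Kt) (Node00.regMSCoPOfRecord F 2 ν Kt k (maxDomT ν.M₁ Z)) (Bj ν.M₁ Z k)
              (avgFamily (Node00.avOfRecord F 2 Kt) (qsstarGIter0 k (expMul su2Chart B' (ext (expMul su2Chart p Vk))))) U' := by
  obtain ⟨R, hR, h⟩ := forall_of_forall_isCompact_subset (plaqsInside (pts k (Z ∩ Λᶜ))) eR
    (fun R Vk =>
      ∃ Ũ : VecField (F.P Kt) k (EuclideanSpace ℂ (Fin 3)) × VecField (F.P Kt) k (EuclideanSpace ℂ (Fin 3)) → PBond (F.P Kt) 0 → Matrix (Fin 2) (Fin 2) ℂ,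
      (∀ b i j, DifferentiableOn ℂ (fun z => Ũ z b i j) (ball 0 R)) ∧
      (∀ z ∈ ball (0 : VecField (F.P Kt) k (EuclideanSpace ℂ (Fin 3)) × VecField (F.P Kt) k (EuclideanSpace ℂ (Fin 3))) R, ∀ b i j, ‖Ũ z b i j‖ ≤ 𝓐₀) ∧
      ∀ p B' : VecField (F.P Kt) k E3, ‖p‖ < R → ‖B'‖ < R → ∃ U' : GaugeField (F.P Kt) 0 SU2,
      (∀ b, Ũ (cplxVec p, cplxVec B') b = ((U' b : SU2) : Matrix (Fin 2) (Fin 2) ℂ)) ∧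
      IsMinimizer (Node00.avOfRecord F 2 Kt) (Node00.regMSCoPOfRecord F 2 ν Kt k (maxDomT ν.M₁ Z)) (Bj ν.M₁ Z k)
      (avgFamily (Node00.avOfRecord F 2 Kt) (qsstarGIter0 k (expMul su2Chart B' (ext (expMul su2Chart p Vk))))) U')
    fun K hK hG => hMin_atRecord_Bj_of_printLetters_hsurjOfClass ν Kt Z (pts k Λ) lo hi hkK hk1 hdiv hfloor hε hα3 hα2 hsbU' hερ hHB hεH
      ext hext hK h𝓐₀ fun Vk hVk => hletters Vk (hG Vk hVk)
  exact ⟨R, hR, fun Vk hVk => h Vk (plaqLeOn_of_plaqSmallOn hVk)⟩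


/-! ## §3  The same from dag-n12-w6 g11's `_ofClass` edition (p707370) — NEITHER dag-n12-w3's plaquette guards `t₀` NOR the surjectivity row -/

/-- ★★★ **THE KNIT's (J0′) ROW SHAPE, UNDER `∃ R > 0`, FROM dag-n12-w6 g11's `hMin_atRecord_Bj_of_printLetters_ofClass` (p707370).**  As §2 with dag-n12-w3's plaquette-guard
conjunct `∃ t₀, …` ALSO removed from the per-base-field letters (orbit tangents are killed in chart currency from `SmallBelow` alone, `N12MinimiserFamilyAtRecordBjNoPlaqGuard` §1–§4):
per base field of the closed guard the consumer supplies EXACTLY the minimiser `U₀` (E), the two (0.4) guards `hsbQ`∕`hsbU`, (β) on every forest axial slice and (T1@q₀); per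
height the letters `hsbU′ hHB` with their floors; numerics.  Read once on the compact closed guard, concluded on the strict guard: the knit's `hMin P i` ∀-body.
((0.4)-regime reading through `hsbQ`∕`hsbU` until the lane's (r3) `_of_guardOn` producer — module docstring.)
[cite: Balaban1989LargeFieldI, (1.74) p.192, Prop. 1 p.194; Balaban1985Variational, Thm 1 p.279, Sect. C (44)–(48) p.285, (82)–(83) p.290, Prop. 9 (190) p.309; Balaban1988Convergent, (2.2) p.255, (2.10)–(2.13) pp.256–257; Balaban1985Averaging, Prop. 2 (52)–(54) p.26; Balaban1987RG1, (0.4) p.253] -/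
theorem exists_R_hMinRow_of_printLetters_ofClass (ν : Node00.Stage7Numerics) (Kt : ℕ) (Z Λ : Set (Site (F.P Kt) 0))
    (lo hi : Fin (F.P Kt).d → ℤ) (hkK : k + 1 ≤ (F.P Kt).m + (F.P Kt).K) (hk1 : 1 ≤ k)
    (hdiv : side (F.P Kt).L ν.M₁ k ∣ (F.P Kt).sitesPerDir 0) (hfloor : ((F.P Kt).d + 14) * (F.P Kt).L ≤ ν.M₁) (hε : 0 < ν.εreg)
    (hα3 : (143 * (((((F.P Kt).d + 4 : ℕ) : ℝ)) ^ 2 / 4) ^ 2) * (2 * ((F.P Kt).L : ℝ) ^ 2 * ν.εreg) ≤ 1 / 3)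
    (hα2 : 2 * (2 * ((F.P Kt).L : ℝ) ^ 2 * ν.εreg) ≤ 2 * deltaSU (Fin 2) / ((((F.P Kt).d + 4) * (F.P Kt).L : ℕ) : ℝ) ^ 2)
    -- the per-HEIGHT letters of `N12HsurjOfClass` (inhabited before `ν`) and their floors
    {ρ'' : ℝ} (hsbU' : ∀ V : GaugeField (F.P Kt) 0 SU2, ‖coeField V - 1‖ ≤ ρ'' → SmallBelow (avOfRecord F 2 Kt) k V)
    (hερ : 6 * ((((F.P Kt).d - 1 : ℕ)) : ℝ) * (F.P Kt).L * ν.εreg ≤ ρ'')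
    {εH B : ℝ}
    (hHB : ∀ (Wd : MSField (F.P Kt) SU2) (U₀ : GaugeField (F.P Kt) 0 SU2),
      AgreeOn (Bj ν.M₁ Z k) (avgFamily (avOfRecord F 2 Kt) U₀) Wd →
      (∀ i' : Fin (constrCard (Bj ν.M₁ Z k) k), ∃ U' : GaugeField (F.P Kt) 0 SU2,
        (∀ b ∈ feeds (((constrEnum (Bj ν.M₁ Z k) k).symm i').1 : ℕ) ((constrEnum (Bj ν.M₁ Z k) k).symm i').2.1, U' b = U₀ b) ∧
          SmallBelow (avOfRecord F 2 Kt) k U') →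
      (∀ (j : ℕ), 1 ≤ j → j ≤ k → ∀ y : Site (F.P Kt) j, embIter j y ∈ maxDomT ν.M₁ Z j → ∃ U' : GaugeField (F.P Kt) 0 SU2,
        (∀ c : PBond (F.P Kt) j, (c.src = y ∨ c.tgt = y) → ∀ b₀ : PBond (F.P Kt) 0,
          (iterBlockOf j b₀.src = c.src ∨ iterBlockOf j b₀.src = c.tgt) → (iterBlockOf j b₀.tgt = c.src ∨ iterBlockOf j b₀.tgt = c.tgt) → U' b₀ = U₀ b₀) ∧
        SmallBelow (avOfRecord F 2 Kt) k U') →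
      (∀ (j : ℕ), 1 ≤ j → j ≤ k → ∀ y : Site (F.P Kt) j, embIter j y ∈ maxDomT ν.M₁ Z j →
        PlaqSmallOn (boxPlaqs (fun κ => lift (F.P Kt) (embIter j y) κ - ((((F.P Kt).L ^ j : ℕ) : ℤ) + ((((F.P Kt).L ^ j - 1) / 2 : ℕ) : ℤ)))
          (fun κ => lift (F.P Kt) (embIter j y) κ + ((((F.P Kt).L ^ j : ℕ) : ℤ) + ((((F.P Kt).L ^ j - 1) / 2 : ℕ) : ℤ))) : Set (Plaq (F.P Kt) 0)) εH U₀) →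
      ∃ H : (Fin (constrCard (Bj ν.M₁ Z k) k) → lieSU (Fin 2)) → PBond (F.P Kt) 0 → lieSU (Fin 2),
        (∀ v, fderiv ℝ (msChart F 2 Kt k (Bj ν.M₁ Z k) Wd U₀) 0 (H v) = v) ∧ ∀ v, Real.sqrt (∑ b, ‖H v b‖ ^ 2) ≤ B * ‖v‖)
    (hεH : ν.εreg ≤ εH)
    (ext : GaugeField (F.P Kt) k SU2 → GaugeField (F.P Kt) k SU2) (hext : ∀ W, ext W = extend (pts k Λ) (shellGauge W lo hi) W)
    {𝓐₀ : ℝ} (h𝓐₀ : 1 < 𝓐₀)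
    (eR : ℝ)
    (hletters : ∀ Vk : GaugeField (F.P Kt) k SU2, (∀ p ∈ plaqsInside (pts k (Z ∩ Λᶜ)), dist1 (GaugeField.plaqHol Vk p) ≤ eR) → ∃ U₀ : GaugeField (F.P Kt) 0 SU2,
      IsMinimizer (Node00.avOfRecord F 2 Kt) (Node00.regMSCoPOfRecord F 2 ν Kt k (maxDomT ν.M₁ Z)) (Bj ν.M₁ Z k)
        (avgFamily (Node00.avOfRecord F 2 Kt) (qsstarGIter0 k (ext Vk))) U₀ ∧
      SmallBelow (Node00.avOfRecord F 2 Kt) k (qsstarGIter0 k (ext Vk)) ∧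
      SmallBelow (Node00.avOfRecord F 2 Kt) k U₀ ∧
      -- DISPLAYED (β) ON EVERY FOREST AXIAL SLICE through the constrained towers of `𝐁_k(Z)` (no `t₀` row, no surjectivity row)
      (∀ (S : Submodule ℂ (VecField (F.P Kt) 0 (EuclideanSpace ℂ (Fin 3)))) (path : Site (F.P Kt) 0 → List (LStep (F.P Kt) 0)),
        (∀ x, ∀ s ∈ path x, ∃ x' x'' : Site (F.P Kt) 0, path x'' = path x' ++ [s] ∧
          (s.fwd = true → s.bond.src = x' ∧ s.bond.tgt = x'') ∧ (s.fwd = false → s.bond.src = x'' ∧ s.bond.tgt = x')) →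
        (∀ j, j ≤ k → ∀ c ∈ bondsOf (Bj ν.M₁ Z k j), path (embIter j c.src) = [] ∧ path (embIter j c.tgt) = []) →
        (∀ X : VecField (F.P Kt) 0 (EuclideanSpace ℂ (Fin 3)), X ∈ S ↔ ∀ x, ∀ s ∈ path x, X s.bond = 0) →
        ∀ ℓ₀ : (Fin (constrCard (Bj ν.M₁ Z k) k) → EuclideanSpace ℂ (Fin 3)) →L[ℂ] ℂ,
          fderiv ℂ (fun X : S => ∑ p : Plaq (F.P Kt) 0, (1 - (expMulC (X : VecField (F.P Kt) 0 (EuclideanSpace ℂ (Fin 3))) (coeField U₀) ⟨p.src, p.μ⟩ *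
            expMulC (X : VecField (F.P Kt) 0 (EuclideanSpace ℂ (Fin 3))) (coeField U₀) ⟨p.src.shift p.μ, p.ν⟩ *
            Matrix.adjugate (expMulC (X : VecField (F.P Kt) 0 (EuclideanSpace ℂ (Fin 3))) (coeField U₀) ⟨p.src.shift p.ν, p.μ⟩) *
            Matrix.adjugate (expMulC (X : VecField (F.P Kt) 0 (EuclideanSpace ℂ (Fin 3))) (coeField U₀) ⟨p.src, p.ν⟩)).trace / 2)) 0 =
            ℓ₀.comp (fderiv ℂ (fun (X : S) (i : Fin (constrCard (Bj ν.M₁ Z k) k)) =>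
              logCoordC (star ((avgFamily (Node00.avOfRecord F 2 Kt) (qsstarGIter0 k (ext Vk))
                ((constrEnum (Bj ν.M₁ Z k) k).symm i).1 ((constrEnum (Bj ν.M₁ Z k) k).symm i).2.1 : SU2) : Matrix (Fin 2) (Fin 2) ℂ) *
                iterMh ((constrEnum (Bj ν.M₁ Z k) k).symm i).1 (expMulC (X : VecField (F.P Kt) 0 (EuclideanSpace ℂ (Fin 3))) (coeField U₀))
                  ((constrEnum (Bj ν.M₁ Z k) k).symm i).2.1)) 0) →
          ∀ (p : VecField (F.P Kt) 0 E3) (hp : cplxVec p ∈ S), p ≠ 0 →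
            (∀ i : Fin (constrCard (Bj ν.M₁ Z k) k), dIterL ((constrEnum (Bj ν.M₁ Z k) k).symm i).1 (coeField U₀)
              (fun b => (∑ a : Fin 3, ((p b a : ℝ) : ℂ) • genE a) * ((U₀ b : SU2) : Matrix (Fin 2) (Fin 2) ℂ)) ((constrEnum (Bj ν.M₁ Z k) k).symm i).2.1 = 0) →
            0 < deriv (deriv (fun t : ℝ => wilsonAction4 (expMul su2Chart (t • p) U₀) -
              (ℓ₀ ((fun (X : S) (i : Fin (constrCard (Bj ν.M₁ Z k) k)) =>
                logCoordC (star ((avgFamily (Node00.avOfRecord F 2 Kt) (qsstarGIter0 k (ext Vk))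
                  ((constrEnum (Bj ν.M₁ Z k) k).symm i).1 ((constrEnum (Bj ν.M₁ Z k) k).symm i).2.1 : SU2) : Matrix (Fin 2) (Fin 2) ℂ) *
                  iterMh ((constrEnum (Bj ν.M₁ Z k) k).symm i).1 (expMulC (X : VecField (F.P Kt) 0 (EuclideanSpace ℂ (Fin 3))) (coeField U₀))
                    ((constrEnum (Bj ν.M₁ Z k) k).symm i).2.1)) ((t : ℂ) • ⟨cplxVec p, hp⟩))).re)) 0) ∧
      -- DISPLAYED (T1@q₀) over the CLOSURE of NODE 00's class: the tower-central orbit of `U₀` is the unique minimal orbit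
      (∀ U ∈ closure (Node00.regMSCoPOfRecord F 2 ν Kt k (maxDomT ν.M₁ Z)),
        AgreeOn (Bj ν.M₁ Z k) (avgFamily (Node00.avOfRecord F 2 Kt) U) (avgFamily (Node00.avOfRecord F 2 Kt) (qsstarGIter0 k (ext Vk))) →
        wilsonAction4 U ≤ wilsonAction4 U₀ →
          ∃ u : GaugeTransf (F.P Kt) 0 SU2, (∀ j, j ≤ k → ∀ b ∈ bondsOf (Bj ν.M₁ Z k j),
            toMS u j b.src = toMS u j b.tgt ∧ ∀ g : SU2, toMS u j b.src * g = g * toMS u j b.src) ∧ gaugeAct u U = U₀)) :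
    ∃ R : ℝ, 0 < R ∧ ∀ Vk : GaugeField (F.P Kt) k SU2, PlaqSmallOn (plaqsInside (pts k (Z ∩ Λᶜ))) eR Vk →
      ∃ Ũ : VecField (F.P Kt) k (EuclideanSpace ℂ (Fin 3)) × VecField (F.P Kt) k (EuclideanSpace ℂ (Fin 3)) → PBond (F.P Kt) 0 → Matrix (Fin 2) (Fin 2) ℂ,
        (∀ b i j, DifferentiableOn ℂ (fun z => Ũ z b i j) (ball 0 R)) ∧
        (∀ z ∈ ball (0 : VecField (F.P Kt) k (EuclideanSpace ℂ (Fin 3)) × VecField (F.P Kt) k (EuclideanSpace ℂ (Fin 3))) R, ∀ b i j, ‖Ũ z b i j‖ ≤ 𝓐₀) ∧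
        ∀ p B' : VecField (F.P Kt) k E3, ‖p‖ < R → ‖B'‖ < R → ∃ U' : GaugeField (F.P Kt) 0 SU2,
          (∀ b, Ũ (cplxVec p, cplxVec B') b = ((U' b : SU2) : Matrix (Fin 2) (Fin 2) ℂ)) ∧
            IsMinimizer (Node00.avOfRecord F 2 Kt) (Node00.regMSCoPOfRecord F 2 ν Kt k (maxDomT ν.M₁ Z)) (Bj ν.M₁ Z k)
              (avgFamily (Node00.avOfRecord F 2 Kt) (qsstarGIter0 k (expMul su2Chart B' (ext (expMul su2Chart p Vk))))) U' := by
  obtain ⟨R, hR, h⟩ := forall_of_forall_isCompact_subset (plaqsInside (pts k (Z ∩ Λᶜ))) eR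
    (fun R Vk =>
      ∃ Ũ : VecField (F.P Kt) k (EuclideanSpace ℂ (Fin 3)) × VecField (F.P Kt) k (EuclideanSpace ℂ (Fin 3)) → PBond (F.P Kt) 0 → Matrix (Fin 2) (Fin 2) ℂ,
      (∀ b i j, DifferentiableOn ℂ (fun z => Ũ z b i j) (ball 0 R)) ∧
      (∀ z ∈ ball (0 : VecField (F.P Kt) k (EuclideanSpace ℂ (Fin 3)) × VecField (F.P Kt) k (EuclideanSpace ℂ (Fin 3))) R, ∀ b i j, ‖Ũ z b i j‖ ≤ 𝓐₀) ∧
      ∀ p B' : VecField (F.P Kt) k E3, ‖p‖ < R → ‖B'‖ < R → ∃ U' : GaugeField (F.P Kt) 0 SU2,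
      (∀ b, Ũ (cplxVec p, cplxVec B') b = ((U' b : SU2) : Matrix (Fin 2) (Fin 2) ℂ)) ∧
      IsMinimizer (Node00.avOfRecord F 2 Kt) (Node00.regMSCoPOfRecord F 2 ν Kt k (maxDomT ν.M₁ Z)) (Bj ν.M₁ Z k)
      (avgFamily (Node00.avOfRecord F 2 Kt) (qsstarGIter0 k (expMul su2Chart B' (ext (expMul su2Chart p Vk))))) U')
    fun K hK hG => hMin_atRecord_Bj_of_printLetters_ofClass ν Kt Z (pts k Λ) lo hi hkK hk1 hdiv hfloor hε hα3 hα2 hsbU' hερ hHB hεH ext hext hK h𝓐₀ (fun Vk hVk => hletters Vk (hG Vk hVk))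
  exact ⟨R, hR, fun Vk hVk => h Vk (plaqLeOn_of_plaqSmallOn hVk)⟩

end Summit.QuantumFields.YangMills.BalabanUVNodes.N12MinimiserFamilyKnitRow

end
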